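import Mathlib
import Summits.Ventures.FusionMHD.Models.CerfonFreidbergNstxLikeQHalfDefs
import HarnessLib

/-!
# Ventures/FusionMHD — Models/CerfonFreidbergNstxLikeQHalfPanels1.lean: KERNEL CHECK of panels 0, 1 (of 32) of the
# certified interior safety factor `q(ψ_N = 1/2)/F` of THE Cerfon–Freidberg NSTX-like instance (twin of `…IterLikeQHalfPanels*.lean`)

HONEST FRAMING (LADDER-GRIDFUSION three columns; CF rung, F2 item R2, NSTX-like twin).  One `decide +kernel` (≈ 103 s on the farm): for
each panel `j` listed, the per-panel obligation `CFNstxLike.QHalf.PanelCert.ok` (`Models/CerfonFreidbergNstxLikeQHalfDefs.lean`) — the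
Taylor-model run of `CFNstxLike.QHalf.progG` over the NSTX-like parameter box is ACCEPTED (every `log`/`sin`/`cos` composition and the `inv`
certificate), and the kernel's panel-integral enclosure of the polar `(6.35)` integrand along the approximant, the range of the flux residual
`U(ray m) − U_a/2`, the range of the approximant `m` and the range of the radial derivative `D_r(θ, m)` lie inside the integers claimed in
`panelCert1` (values read off a compiled `#eval` of the same functions, slack one unit of `2⁻⁶⁰`; probe `QProbeNF*.lean`, generator
`pub/gridfusion/models/gen-model-5/g8/mkdefsN.py`).  What these Booleans MEAN (real-number statements, uniformly over the parameter box ∋ THE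
NSTX-like instance) is proved once in `Models/CerfonFreidbergNstxLikeQHalfSound.lean`.  MODELLED: analytic Cerfon–Freidberg family; `q` of a
MODEL surface — nothing about a device or stability.  No `native_decide`.  Typer/prover: gridfusion-model-5 (g8), 2026-08-27.
Citations: Freidberg 2014 §6.3.5 (6.35) [Freidberg2014]; Mahboubi–Melquiond–Sibut-Pinote 2016 §3.2 Lemma 3 [MahboubiMelquiondSibutpinote2016].
-/

namespace Summit.Ventures.FusionMHD.Models.CFNstxLike.QHalf

/-- The certificate data of panels 0, 1 (NSTX-like): `inv` candidate (degree-12 fit of `(X·D_r)⁻¹` in the panel variable, scaled by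
`2⁶⁰`), Taylor degree, `inv` widening `2^elog2`, and the claimed integral / residual / `m`-range / `D_r`-range integers (× `2⁶⁰`). [instance data] -/
def panelCert1 : List PanelCert := [
  { j := 0, cand := [966740717640646272, 110164029027597600, 3534227828058431488, 575352133399265408, 9260795511295277056, 1885524413002452224, 33778097328104505344, 2051700506172734308352, -126791527563677692592128, -7720114746652167195590656, 543622225943414161585209344, 11058434020732076896680935424, -822795012830493943216107159552],
    deg := 14, elog2 := 37, plo := 35956763037538084, phi := 35956774983731357, eta := 11441339595, mlo := 435407715389934082, mhi := 437656887991932638,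
    dlo := 833110405052495675, dhi := 837170837065488077 },
  { j := 1, cand := [973661212788037632, 333883619448016768, 3643412545091274240, 1768095710658307840, 9942329697584345088, 6698277586194148352, 26690233329025896448, 47480574243075014656, -775722179021087703040, -15543365208886281764864, 1717097647706972727803904, -4723263582480229606621184, -1417304738526069373836197888],
    deg := 12, elog2 := 30, plo := 36464359175663370, phi := 36464359271769497, eta := 106731634, mlo := 436887192382060055, mhi := 442191062756706922,
    dlo := 825030236621000771, dhi := 834449851836463092 }]

/-- **KERNEL CHECK** of panels 0, 1 of the NSTX-like surface `ψ_N = 1/2`. -/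
theorem panelCert1_ok : CFNstxLike.QHalf.panelCert1.all PanelCert.ok = true := by
  decide +kernel

end Summit.Ventures.FusionMHD.Models.CFNstxLike.QHalf
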